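import Summits.ResolutionOfSingularities.ResolutionOfSingularities.Theorems.FrobeniusClosingSteerOddBranchVFree
import Summits.ResolutionOfSingularities.ResolutionOfSingularities.Theorems.FrobeniusClosingSteerWords03Phases

/-!
# Crux `Steer` (stmt-ResolutionOfSingularities-16345), chain W4.1, F-B side: the (Par-P) branch
# «a PERSISTENT tail parameter closes the run» — threading the steered tower into the V-free squeeze
# (res-L0-w41-plan-1 RULING 101 (ii) / RULING 104a; res-L0-w41-strat-2 §σ2.27 v1.2 `StrippingTailPersistentConclTwoN`;
# res-L0-w41-tri-1 g5 PREREG-FB v1.6 D·S6 (P3)–(P5); Theses-free support)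

OURS (campaign `res-hironaka`, rung L ★L-G4, slot W4.1; statements about the route's own objects — a tower
`R 0 ≤ R 1 ≤ ⋯ ⊆ O` of subrings of a field `K` obtained by local blowing ups along a valuation ring `O`
(`Literature…LocalBlowup.IsLocalBlowupAlong`, Novacoski–Spivakovsky Def. 2.11), the torsor datum `t ^ p ∈ A₀`,
`K = Frac k[A₀, t]`; they replace the role of no printed item and are NOT statements of the manuscript under review
[claim: Hironaka2017, status: under-review]; AI review is weaker than expert review). Seat res-type-062 g15.
Definition-free; no Theses file of W4.1 is imported; nothing here is a route item.

## What is proved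

* §1 `le_valuationSubring_of_seq`, `le_succ_of_seq`, `monotone_of_seq`, `le_of_seq` — along a tower of local blowing ups
  `IsLocalBlowupAlong O (R i) (P i) (R (i+1))` the members are dominated by `O` and increase.
* §2 (P3a) `div_mem_of_isLocalBlowupAlong` — THREADING BRICK: if `x` is an exceptional parameter of the local blowing up
  `B ↦ B'` along `I` (an element of `I`, non-zero, of maximal `O`-value on `I` — the body of the skeleton's `IsExcParamAlong`,
  UNFOLDED), then `y / x ∈ B'` for every `y ∈ I` (`I·B' = x·B'`; one line over res-D-pv-011's
  `GeoDict.exists_mem_mul_of_isExcParamAlong`); and `weakPersistence_of_pointSteps` — the WEAK persistence clause of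
  tri-1's `VFree` («every late `y ∈ R i` of value `< 1` becomes divisible by `x` in SOME later member») follows as soon as
  beyond every late stage there is a stage `j` whose centre `P j` contains the whole centre of `O` on `R j` (a POINT step)
  and admits `x` as exceptional parameter — tri-1's bridge «branch (O) ⊆ persistent half» (D·S6 (P3)), research side.
* §3 `exists_pow_eq_div_of_isFractionRing_adjoin` — the torsor situation supplies `VFree`'s `hK` with `N = p`: if
  `K = Frac k[A₀, t]`, `t ^ p ∈ A₀ ⊆ S` (characteristic `p`), then `z ^ p` is a quotient of non-zero elements of `S` for every
  `z ≠ 0` (Frobenius; `OddBranchVFree.pow_char_eq_div_of_frac`).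
* §4 `discrete_of_persistentTail`, `discrete_of_persistentTail_of_seq` — persistent tail parameter (weak clause) + no proper
  coarsening + the torsor fraction field ⇒ `Discrete O` (`OddBranchVFree.discrete_of_persistent'`, res-type-038's
  `ValuationRank.hasProperCoarsening_of_forall_pow_dvd` inside); `concl_of_coreDatum_of_persistentTail` — hence, for a CORE DATUM
  (`Words.CoreDatum`: `t ^ p ∈ A₀`, `Frac k[A₀, t] = K`, `¬ Discrete O`, …) and the T-line binder `¬ HasProperCoarsening O`,
  the persistence clause is ABSURD, so `Concl O A₀ t` holds — this is the whole content of strat-2's (Par-P) word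
  `StrippingTailPersistentConclTwoN` (§σ2.27 v1.2), whose holder's leaf is `intro …; exact concl_of_coreDatum_of_persistentTail …`
  with `hbl i` read off `IsSteeredRun` (the other F-B-wild binders are not used).

[cite: NovacoskiSpivakovsky2014, Def. 2.11] [cite: HeinzerEtAl2015, Remark 2.4] [folklore]
-/

-- `Summit.<S>.<S>.…` duplicates the summit name by design (single-problem summit).
set_option linter.dupNamespace false

open Literature.AlgebraicGeometry.Resolution (locAtCentre le_locAtCentre IsLocalBlowupAlong)

namespace Summit.ResolutionOfSingularities.ResolutionOfSingularities.Theorems.SwitchingDichotomy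

namespace OddBranchPersistence

open Summit.ResolutionOfSingularities.ResolutionOfSingularities.Theorems.SteerRankThinness (HasProperCoarsening Concl)
open Summit.ResolutionOfSingularities.ResolutionOfSingularities.Theorems.SwitchingDichotomy.Words (Discrete CoreDatum)
open OddBranchVFree

variable {K : Type} [Field K]

/-! ## §1 Towers of local blowing ups along `O`: members are dominated by `O` and increase -/

section Tower

variable {O : ValuationSubring K} {R : ℕ → Subring K} {P : (i : ℕ) → Ideal (R i)}

/-- Every member of a tower of local blowing ups along `O` lies in `O`. [cite: NovacoskiSpivakovsky2014, Def. 2.11] -/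
theorem le_valuationSubring_of_seq (hbl : ∀ i, IsLocalBlowupAlong O (R i) (P i) (R (i + 1))) (i : ℕ) :
    R i ≤ O.toSubring :=
  (hbl i).1

/-- Consecutive members of a tower of local blowing ups increase: `R i ≤ R (i+1)`. [cite: NovacoskiSpivakovsky2014, Def. 2.8] -/
theorem le_succ_of_seq (hbl : ∀ i, IsLocalBlowupAlong O (R i) (P i) (R (i + 1))) (i : ℕ) :
    R i ≤ R (i + 1) :=
  (hbl i).isLocalBlowup.le

/-- The members of a tower of local blowing ups form a monotone sequence of subrings. [folklore] -/
theorem monotone_of_seq (hbl : ∀ i, IsLocalBlowupAlong O (R i) (P i) (R (i + 1))) : Monotone R :=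
  monotone_nat_of_le_succ (le_succ_of_seq hbl)

/-- `R i ≤ R j` for `i ≤ j` along a tower of local blowing ups. [folklore] -/
theorem le_of_seq (hbl : ∀ i, IsLocalBlowupAlong O (R i) (P i) (R (i + 1))) {i j : ℕ} (hij : i ≤ j) :
    R i ≤ R j :=
  monotone_of_seq hbl hij

end Tower

/-! ## §2 (P3a) the exceptional parameter divides the centre in the next member; the weak persistence clause from point steps -/

section Threading

variable {O : ValuationSubring K}

/-- **(P3a) threading brick.** Along the local blowing up `B'` of `B` along `I` with respect to `O`, an EXCEPTIONAL
PARAMETER `x` (an element of `I`, non-zero, of maximal `O`-value on `I` — the skeleton's `IsExcParamAlong O B I x`, unfolded)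
divides every element of the centre in the new member: `y / x ∈ B'` for all `y ∈ I` (`I·B' = u₀·B' = x·B'`, `u₀ / x` a unit of
`B'`). [cite: NovacoskiSpivakovsky2014, Def. 2.11] [folklore] -/
theorem div_mem_of_isLocalBlowupAlong {B B' : Subring K} {I : Ideal B} (hbl : IsLocalBlowupAlong O B I B') {x : K}
    (hxI : ∃ hx : x ∈ B, (⟨x, hx⟩ : B) ∈ I) (hx0 : x ≠ 0)
    (hmax : ∀ y : B, y ∈ I → O.valuation (y : K) ≤ O.valuation x) :
    ∀ y : B, y ∈ I → (y : K) / x ∈ B' := by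
  intro y hy
  obtain ⟨r, hr, hyr⟩ := GeoDict.exists_mem_mul_of_isExcParamAlong hbl hxI hx0 hmax y hy
  rw [hyr, mul_div_assoc, div_self hx0, mul_one]
  exact hr

/-- **The weak persistence clause from point steps** (tri-1's bridge «branch (O) ⊆ persistent half», D·S6 (P3)): along a
tower of local blowing ups, suppose that beyond every stage `i ≥ i₀` there is a stage `j ≥ i` whose centre `P j` contains
every element of `R j` of positive `O`-value (a POINT step: the centre is the centre of `O` on `R j`) and admits `x` as an
exceptional parameter. Then every `y ∈ R i`, `i ≥ i₀`, of value `< 1` becomes divisible by `x` in some later member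
(namely `R (j+1)`): the WEAK hypothesis `h` of `OddBranchVFree.valuation_eq_pow_of_persistent'` /
`OddBranchVFree.discrete_of_persistent'`. [folklore] -/
theorem weakPersistence_of_pointSteps {R : ℕ → Subring K} {P : (i : ℕ) → Ideal (R i)}
    (hbl : ∀ i, IsLocalBlowupAlong O (R i) (P i) (R (i + 1))) {x : K} (hx0 : x ≠ 0) {i₀ : ℕ}
    (hpt : ∀ i, i₀ ≤ i → ∃ j, i ≤ j ∧
      (∀ y : R j, O.valuation (y : K) < 1 → y ∈ P j) ∧
      (∃ hx : x ∈ R j, (⟨x, hx⟩ : R j) ∈ P j) ∧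
      (∀ y : R j, y ∈ P j → O.valuation (y : K) ≤ O.valuation x)) :
    ∀ i, i₀ ≤ i → ∀ y ∈ R i, O.valuation y < 1 → ∃ j, i < j ∧ y / x ∈ R j := by
  intro i hi y hy hvy
  obtain ⟨j, hij, hcentre, hxP, hmax⟩ := hpt i hi
  have hyj : y ∈ R j := le_of_seq hbl hij hy
  refine ⟨j + 1, Nat.lt_succ_of_le hij, ?_⟩
  exact div_mem_of_isLocalBlowupAlong (hbl j) hxP hx0 hmax ⟨y, hyj⟩ (hcentre ⟨y, hyj⟩ hvy)

end Threading

/-! ## §3 The torsor fraction field supplies `hK`: `z ^ p` is a quotient of elements of any member containing `A₀` -/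

section Torsor

variable {k : Type} [Field k] [Algebra k K]

/-- In characteristic `p`, if `K` is the fraction field of `k[A₀, t]` with `t ^ p ∈ A₀`, then for every subring `S ⊇ A₀`
and every `z ≠ 0` in `K`, `z ^ p = a / b` with `a, b ∈ S` non-zero (write `z = P / Q` with `P, Q ∈ k[A₀, t] ⊆ S[t]` and apply
Frobenius: `P ^ p, Q ^ p ∈ S`). [folklore] -/
theorem exists_pow_eq_div_of_isFractionRing_adjoin (p : ℕ) [Fact p.Prime] [CharP K p] (A₀ : Subalgebra k K) (t : K)
    (htp : t ^ p ∈ A₀) (hfr : IsFractionRing (Algebra.adjoin k (insert t (A₀ : Set K))) K)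
    (S : Subring K) (hS : A₀.toSubring ≤ S) {z : K} (hz : z ≠ 0) :
    ∃ a ∈ S, ∃ b ∈ S, a ≠ 0 ∧ b ≠ 0 ∧ z ^ p = a / b := by
  refine pow_char_eq_div_of_frac p S t (hS htp) (fun w hw => ?_) hz
  haveI := hfr
  obtain ⟨a, b, hb, hab⟩ := IsFractionRing.div_surjective (A := Algebra.adjoin k (insert t (A₀ : Set K))) w
  have hsub : Set.range (algebraMap k K) ∪ insert t (A₀ : Set K) ⊆ (S : Set K) ∪ {t} := by
    rintro y (⟨c, rfl⟩ | hy)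
    · exact Or.inl (hS (A₀.algebraMap_mem c))
    · rcases (Set.mem_insert_iff).mp hy with rfl | hy
      · exact Or.inr rfl
      · exact Or.inl (hS hy)
  have hmem : ∀ c : Algebra.adjoin k (insert t (A₀ : Set K)), (c : K) ∈ Subring.closure ((S : Set K) ∪ {t}) := by
    intro c
    have hc : (c : K) ∈ Subring.closure (Set.range (algebraMap k K) ∪ insert t (A₀ : Set K)) :=
      Algebra.mem_adjoin_iff.mp c.2
    exact Subring.closure_mono hsub hc
  have hb0 : (b : K) ≠ 0 := by
    have hb' : b ≠ 0 := nonZeroDivisors.ne_zero hb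
    exact fun e => hb' (Subtype.ext e)
  have hab' : (a : K) / (b : K) = w := hab
  have ha0 : (a : K) ≠ 0 := by
    intro e
    apply hw
    rw [← hab', e, zero_div]
  exact ⟨a, hmem a, b, hmem b, ha0, hb0, hab'.symm⟩

end Torsor

/-! ## §4 A persistent tail parameter forces a discrete valuation; (Par-P) for core data -/

section Persistent

variable {k : Type} [Field k] [Algebra k K]

/-- **Persistent tail parameter ⇒ discrete.** Let `R 0 ≤ R 1 ≤ ⋯ ⊆ O` be subrings with `A₀ ⊆ R 0`, `K = Frac k[A₀, t]`,
`t ^ p ∈ A₀` (characteristic `p` prime), `O` without proper coarsening. If some `x ∈ O`, `x ≠ 0`, `v x < 1`, has the WEAK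
persistence property «every `y ∈ R i` (`i ≥ i₀`) of value `< 1` satisfies `y / x ∈ R j` for some `j > i`», then `O` is
discrete of rank one (`Words.Discrete`). (tri-1's V-free squeeze `OddBranchVFree.discrete_of_persistent'` with `N = p` and
`hK` from §3.) [cite: HeinzerEtAl2015, Remark 2.4] [folklore] -/
theorem discrete_of_persistentTail (p : ℕ) (hp : p.Prime) [CharP K p] (O : ValuationSubring K)
    (A₀ : Subalgebra k K) (t : K) (htp : t ^ p ∈ A₀)
    (hfr : IsFractionRing (Algebra.adjoin k (insert t (A₀ : Set K))) K) (hnc : ¬ HasProperCoarsening O)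
    (R : ℕ → Subring K) (hRO : ∀ i, R i ≤ O.toSubring) (hmono : Monotone R) (hA₀R : A₀.toSubring ≤ R 0)
    (hpers : ∃ i₀ : ℕ, ∃ x : K, x ≠ 0 ∧ x ∈ O ∧ O.valuation x < 1 ∧
      ∀ i, i₀ ≤ i → ∀ y ∈ R i, O.valuation y < 1 → ∃ j, i < j ∧ y / x ∈ R j) :
    Discrete O := by
  haveI : Fact p.Prime := ⟨hp⟩
  obtain ⟨i₀, x, hx0, hxO, hvx, h⟩ := hpers
  exact discrete_of_persistent' O R x i₀ p hRO ⟨hxO, hvx⟩ hx0 h hnc hp.ne_zero fun z hz =>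
    exists_pow_eq_div_of_isFractionRing_adjoin p A₀ t htp hfr (R i₀) (hA₀R.trans (hmono (Nat.zero_le i₀))) hz

/-- The same along a TOWER OF LOCAL BLOWING UPS starting at `R 0 = (A₀)_{𝔪_O ∩ A₀}` (the members of a steered run:
`IsLocalBlowupAlong O (R i) (P i) (R (i+1))` for every `i`). [cite: NovacoskiSpivakovsky2014, Def. 2.11] [folklore] -/
theorem discrete_of_persistentTail_of_seq (p : ℕ) (hp : p.Prime) [CharP K p] (O : ValuationSubring K)
    (A₀ : Subalgebra k K) (t : K) (htp : t ^ p ∈ A₀)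
    (hfr : IsFractionRing (Algebra.adjoin k (insert t (A₀ : Set K))) K) (hnc : ¬ HasProperCoarsening O)
    (R : ℕ → Subring K) (P : (i : ℕ) → Ideal (R i)) (hR0 : R 0 = locAtCentre A₀.toSubring O)
    (hbl : ∀ i, IsLocalBlowupAlong O (R i) (P i) (R (i + 1)))
    (hpers : ∃ i₀ : ℕ, ∃ x : K, x ≠ 0 ∧ x ∈ O ∧ O.valuation x < 1 ∧
      ∀ i, i₀ ≤ i → ∀ y ∈ R i, O.valuation y < 1 → ∃ j, i < j ∧ y / x ∈ R j) :
    Discrete O :=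
  discrete_of_persistentTail p hp O A₀ t htp hfr hnc R (le_valuationSubring_of_seq hbl) (monotone_of_seq hbl)
    (hR0 ▸ le_locAtCentre A₀.toSubring O) hpers

/-- **(Par-P) for core data.** For a CORE DATUM `(O, A₀, t)` at `(p, n)` (`Words.CoreDatum`: in particular `t ^ p ∈ A₀`,
`Frac k[A₀, t] = K` and `¬ Discrete O`) over a ground field of prime characteristic `p`, the T-line binder
`¬ HasProperCoarsening O`, and ANY tower of local blowing ups `R 0 = (A₀)_{𝔪_O ∩ A₀} ≤ R 1 ≤ ⋯` along `O`, the weak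
persistence clause is absurd; in particular the conclusion `Concl O A₀ t` holds. This is the content of res-L0-w41-strat-2's
word `StrippingTailPersistentConclTwoN` (§σ2.27 v1.2; there `p = 2`, `n = 4`, and the tower is the σ_top-steered run).
[cite: HeinzerEtAl2015, Remark 2.4] [folklore] -/
theorem concl_of_coreDatum_of_persistentTail (p n : ℕ) (hp : p.Prime) {k K : Type} [Field k] [CharP k p] [Field K]
    [Algebra k K] (O : ValuationSubring K) (A₀ : Subalgebra k K) (h₀ : A₀.toSubring ≤ O.toSubring) (t : K)
    (core : CoreDatum p n k K O A₀ h₀ t) (hnc : ¬ HasProperCoarsening O)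
    (R : ℕ → Subring K) (P : (i : ℕ) → Ideal (R i)) (hR0 : R 0 = locAtCentre A₀.toSubring O)
    (hbl : ∀ i, IsLocalBlowupAlong O (R i) (P i) (R (i + 1)))
    (hpers : ∃ i₀ : ℕ, ∃ x : K, x ≠ 0 ∧ x ∈ O ∧ O.valuation x < 1 ∧
      ∀ i, i₀ ≤ i → ∀ y ∈ R i, O.valuation y < 1 → ∃ j, i < j ∧ y / x ∈ R j) :
    Concl O A₀ t := by
  haveI : CharP K p := charP_of_injective_algebraMap (algebraMap k K).injective p
  obtain ⟨-, htp, hfr, -, -, -, -, -, -, hnd, -⟩ := core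
  exact absurd (discrete_of_persistentTail_of_seq p hp O A₀ t htp hfr hnc R P hR0 hbl hpers) hnd

/-- **(Par-P) at `p = 2`, `n = 4`** — literally the binders of `StrippingTailPersistentConclTwoN` that are used (the run's
blow-up clauses `hbl`, read off `IsSteeredRun` by the holder's leaf). [folklore] -/
theorem concl_of_coreDatum_of_persistentTail_two (p : ℕ) (hp2 : p = 2) {k K : Type} [Field k] [CharP k p] [Field K]
    [Algebra k K] (O : ValuationSubring K) (A₀ : Subalgebra k K) (h₀ : A₀.toSubring ≤ O.toSubring) (t : K)
    (core : CoreDatum p 4 k K O A₀ h₀ t) (hnc : ¬ HasProperCoarsening O)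
    (R : ℕ → Subring K) (P : (i : ℕ) → Ideal (R i)) (hR0 : R 0 = locAtCentre A₀.toSubring O)
    (hbl : ∀ i, IsLocalBlowupAlong O (R i) (P i) (R (i + 1)))
    (hpers : ∃ i₀ : ℕ, ∃ x : K, x ≠ 0 ∧ x ∈ O ∧ O.valuation x < 1 ∧
      ∀ i, i₀ ≤ i → ∀ y ∈ R i, O.valuation y < 1 → ∃ j, i < j ∧ y / x ∈ R j) :
    Concl O A₀ t :=
  concl_of_coreDatum_of_persistentTail p 4 (hp2 ▸ Nat.prime_two) O A₀ h₀ t core hnc R P hR0 hbl hpers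

end Persistent

end OddBranchPersistence

end Summit.ResolutionOfSingularities.ResolutionOfSingularities.Theorems.SwitchingDichotomy
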